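import Summits.Ventures.PercRepro.C026HubAttachH

/-!
# Hub attachment and the D-free inequality, IX: the theorem (p5, gen 10)

* **`sigCount_link_le_sigB`** (`N₀₀₁ ≤ N₀₁₀`) — the `a ↔ b` symmetry of `sigCount_link_le_sigA`
  (`sigCount_swap`: the counts of `(b, a, c)` are those of `(a, b, c)` with the first two bits swapped);
* **`dFreeFrozen_of_hubs`** — THE HUB ATTACHMENT THEOREM: for a set `Hs` of hubs (non-marks adjacent
  only to the marks, any multiplicities) and a frozen set `F` disjoint from the hub edges, the frozen
  D-free inequality with the hub edges frozen as well implies the frozen D-free inequality: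
  `DFreeFrozen (F ∪ E[Hs]) a b c → DFreeFrozen F a b c`;
* **`dFreeIneq_of_hubs`** — `F = ∅`: `DFreeFrozen E[Hs] a b c → DFreeIneq a b c`, i.e. the (★)-slack of
  the graph with the hubs' edges deleted nonnegative gives the (★)-slack of `G` nonnegative;
* **`dFreeIneq_of_hubs_of_isolated`** — when every edge at `c` is a hub edge (mine-3's Theorem′ family
  on `c`'s side) the hypothesis is automatic: `DFreeIneq a b c` outright.
-/

namespace PercRepro

namespace MultiGraph

variable {V E : Type*} {G : MultiGraph V E}

/-! ### The `a ↔ b` symmetry of the counts -/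

section Swap

variable {Hs : Set V} {a b c : V} {σ : Config E}

/-- `SingleDir` is symmetric in `a, b`. -/
theorem singleDir_swap_iff : G.SingleDir Hs b a c σ ↔ G.SingleDir Hs a b c σ := by
  unfold SingleDir
  constructor
  · intro h x hx
    obtain ⟨h1, h2, h3⟩ := h x hx
    exact ⟨fun h' => h1 ⟨h'.2, h'.1⟩, h3, h2⟩
  · intro h x hx
    obtain ⟨h1, h2, h3⟩ := h x hx
    exact ⟨fun h' => h1 ⟨h'.2, h'.1⟩, h3, h2⟩

/-- `SigLink` is symmetric in `a, b`. -/
theorem sigLink_swap_iff (X : Set V) : G.SigLink Hs X σ b a c ↔ G.SigLink Hs X σ a b c := by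
  unfold SigLink
  constructor
  · rintro ⟨h, hh, hX, h1, h2, h3, h4⟩
    exact ⟨h, hh, hX, h1, h2, h4, h3⟩
  · rintro ⟨h, hh, hX, h1, h2, h3, h4⟩
    exact ⟨h, hh, hX, h1, h2, h4, h3⟩

variable [Fintype E] [DecidableEq E]

open Classical in
/-- The signature counts of `(b, a, c)` are those of `(a, b, c)` with the first two bits swapped. -/
theorem sigCount_swap (s₁ s₂ s₃ : Bool) :
    G.sigCount Hs b a c (s₁, s₂, s₃) = G.sigCount Hs a b c (s₂, s₁, s₃) := by
  unfold sigCount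
  congr 1
  refine Finset.filter_congr fun σ _ => ?_
  rw [singleDir_swap_iff]
  simp only [sigOf, Prod.mk.injEq, sigLink_swap_iff]
  tauto

open Classical in
/-- **`N₀₀₁ ≤ N₀₁₀`** (the `a ↔ b` symmetry of `sigCount_link_le_sigA`). -/
theorem sigCount_link_le_sigB (hH : G.IsHubSet Hs a b c) (hab : a ≠ b) (hac : a ≠ c)
    (hbc : b ≠ c) :
    G.sigCount Hs a b c (false, false, true) ≤ G.sigCount Hs a b c (false, true, false) := by
  calc G.sigCount Hs a b c (false, false, true) = G.sigCount Hs b a c (false, false, true) :=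
        (sigCount_swap false false true).symm
    _ ≤ G.sigCount Hs b a c (true, false, false) := sigCount_link_le_sigA hH.swap hab.symm hbc hac
    _ = G.sigCount Hs a b c (false, true, false) := sigCount_swap true false false

end Swap

/-! ### The hub attachment theorem -/

section Main

variable [Fintype E] [DecidableEq E] {Hs : Set V} {a b c : V}

omit [Fintype E] [DecidableEq E] in
/-- Freezing a union. -/
theorem frozen_union_iff (F₁ F₂ : Set E) (ω : Config E) :
    Frozen (F₁ ∪ F₂) ω ↔ Frozen F₁ ω ∧ Frozen F₂ ω := by
  constructor
  · intro h
    exact ⟨fun e he => h e (Or.inl he), fun e he => h e (Or.inr he)⟩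
  · rintro ⟨h1, h2⟩ e he
    rcases he with he | he
    · exact h1 e he
    · exact h2 e he

open Classical in
/-- Without three distinct marks there is no `bot` configuration and the inequality is trivial. -/
theorem dFreeFrozen_of_not_distinct (F : Set E) (hnd : ¬ (a ≠ b ∧ a ≠ c ∧ b ≠ c)) :
    G.DFreeFrozen F a b c := by
  unfold DFreeFrozen
  have : (Finset.univ.filter fun ω : Config E => Frozen F ω ∧ G.IsBot ω a b c ∧ G.HConn ω c a b) =
      ∅ := by
    refine Finset.filter_eq_empty_iff.2 fun ω _ h => hnd ⟨h.2.1.ne_ab, h.2.1.ne_ac, h.2.1.ne_bc⟩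
  rw [this, Finset.card_empty]
  exact Nat.zero_le _

open Classical in
/-- **THE HUB ATTACHMENT THEOREM.**  Let `Hs` be a set of hubs of the marked multigraph `G` (non-marks
adjacent only to the marks `a, b, c`, with any multiplicities) and `F` a set of edges disjoint from
the hub edges `E[Hs]`.  If the D-free inequality holds on the configurations with `F ∪ E[Hs]` closed
(the (★)-slack of the graph with the hubs' edges removed), it holds on the configurations with `F`
closed.  mine-3's counting identity (dossier §21.9 (iii)–(iv)) in the kernel: every configuration is
a base plus a hub part, the weight is the table of the signature bits, and the link configurations
inject into the one-sided ones. -/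
theorem dFreeFrozen_of_hubs (hH : G.IsHubSet Hs a b c) (F : Set E)
    (hdisj : ∀ e ∈ F, e ∉ G.edgesAt Hs) (h : G.DFreeFrozen (F ∪ G.edgesAt Hs) a b c) :
    G.DFreeFrozen F a b c := by
  by_cases hd : a ≠ b ∧ a ≠ c ∧ b ≠ c
  · obtain ⟨hab, hac, hbc⟩ := hd
    rw [dFreeFrozen_iff_sum] at h ⊢
    rw [sum_frozen_eq_sum_join Hs hdisj]
    have hfilter : (Finset.univ.filter fun ω : Config E => Frozen (F ∪ G.edgesAt Hs) ω) =
        Finset.univ.filter fun β : Config E => Frozen F β ∧ Frozen (G.edgesAt Hs) β := by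
      refine Finset.filter_congr fun ω _ => frozen_union_iff F _ ω
    rw [hfilter] at h
    have hN1 := sigCount_link_le_sigA hH hab hac hbc
    have hN2 := sigCount_link_le_sigB hH hab hac hbc
    calc (0 : ℤ) ≤ ((G.sigCount Hs a b c (false, false, false) +
          G.sigCount Hs a b c (false, false, true) : ℕ) : ℤ) *
          ∑ β ∈ Finset.univ.filter (fun β : Config E => Frozen F β ∧ Frozen (G.edgesAt Hs) β),
            G.starWeight a b c β := by positivity
      _ = ∑ β ∈ Finset.univ.filter (fun β : Config E => Frozen F β ∧ Frozen (G.edgesAt Hs) β),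
            ((G.sigCount Hs a b c (false, false, false) +
              G.sigCount Hs a b c (false, false, true) : ℕ) : ℤ) * G.starWeight a b c β := by
          rw [Finset.mul_sum]
      _ ≤ _ := by
          refine Finset.sum_le_sum fun β hβ => ?_
          simp only [Finset.mem_filter, Finset.mem_univ, true_and] at hβ
          exact sum_starWeight_join_ge hH hN1 hN2 hβ.2
  · exact dFreeFrozen_of_not_distinct F hd

open Classical in
/-- **Hub attachment, `F = ∅`**: the D-free inequality of `G` follows from the D-free inequality on
the configurations with the hubs' edges closed. -/
theorem dFreeIneq_of_hubs (hH : G.IsHubSet Hs a b c) (h : G.DFreeFrozen (G.edgesAt Hs) a b c) :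
    G.DFreeIneq a b c := by
  rw [dFreeIneq_iff_dFreeFrozen_empty]
  refine dFreeFrozen_of_hubs hH ∅ (fun e he => he.elim) ?_
  rwa [Set.empty_union]

open Classical in
/-- **The `c`-side of mine-3's Theorem′ as a count**: when every edge at `c` is a hub edge, the
frozen inequality is trivial (`c` is then isolated, no configuration is `bot` with `a ~_H b`), so the
D-free inequality holds outright. -/
theorem dFreeIneq_of_hubs_of_isolated (hH : G.IsHubSet Hs a b c)
    (hc : ∀ e, (G.fst e = c ∨ G.snd e = c) → e ∈ G.edgesAt Hs) : G.DFreeIneq a b c := by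
  refine dFreeIneq_of_hubs hH ?_
  unfold DFreeFrozen
  have : (Finset.univ.filter fun ω : Config E =>
      Frozen (G.edgesAt Hs) ω ∧ G.IsBot ω a b c ∧ G.HConn ω c a b) = ∅ := by
    refine Finset.filter_eq_empty_iff.2 fun ω _ h => ?_
    obtain ⟨hfr, hbot, hconn⟩ := h
    -- `c` is isolated: `M = {c}`, and every H-step from `c` leads to a hub, a dead end; an H-walk
    -- from `a` to `b` cannot use `c`, and outside `c` there are no H-edges at all
    have hM : ∀ z, z ∈ G.cluster ω c → z = c := by
      intro z hz
      refine Conn.induction (motive := fun z => z = c) rfl ?_ hz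
      rintro u v - ⟨e, he, hend⟩ rfl
      have : e ∈ G.edgesAt Hs := hc e (by
        rcases hend with ⟨h1, -⟩ | ⟨-, h2⟩
        · exact Or.inl h1
        · exact Or.inr h2)
      rw [hfr e this] at he
      exact Bool.noConfusion he
    -- an H-step from a vertex other than `c` stays in its own cluster; so `a ~_H b` would need
    -- `a ~ b`, contradicting `bot`
    have hstep : ∀ u v, G.HAdj ω c u v → u ≠ c → v ≠ c → G.Conn ω u v := by
      intro u v hadj hu hv
      rcases hadj with ⟨huM, -⟩ | ⟨hiff, e, hj⟩ | ⟨-, -, hconn'⟩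
      · exact (hu (hM u huM)).elim
      · -- an edge between `M = {c}` and the rest has `c` as an endpoint
        exfalso
        by_cases huM : u ∈ G.cluster ω c
        · exact hu (hM u huM)
        · exact hv (hM v (by by_contra hvM; exact huM (hiff.2 hvM)))
      · exact hconn'
    -- walks from `a` never reach `c`
    have hwalk : ∀ z, G.HConn ω c a z → z ≠ c ∧ G.Conn ω a z := by
      intro z hz
      induction hz with
      | refl => exact ⟨hbot.ne_ac, Conn.refl G ω a⟩
      | @tail y z _ hstep' ih =>
        by_cases hzc : z = c
        · subst z
          -- the step `y → c` with `y ≠ c`: kind 2 with an edge at `c` — a hub edge, so `y` is a hub,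
          -- but `y ~ a` and hubs with an open edge are open to a mark; `y` is in `K`, not `M`...
          exfalso
          rcases hstep' with ⟨hyM, -⟩ | ⟨-, e, hj⟩ | ⟨-, hcM, -⟩
          · exact ih.1 (hM y hyM)
          · -- `e` joins `y` and `c`: a hub edge, closed; its hub endpoint is `y`
            have he : e ∈ G.edgesAt Hs := hc e (by
              rcases hj with ⟨-, h2⟩ | ⟨h1, -⟩
              · exact Or.inr h2
              · exact Or.inl h1)
            obtain ⟨h', hh', m, -, hl'⟩ := hH.link_of_mem_edgesAt he
            -- `y` is the hub endpoint
            have hy : y = h' := by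
              rcases hj.link.cases hl' with ⟨h1, -⟩ | ⟨-, h2⟩
              · exact h1
              · exact (hH.mark_notMem (Or.inr (Or.inr rfl)) (h2 ▸ hh')).elim
            subst hy
            -- a hub connected to `a` is open to `a` (its edges are hub edges, closed): impossible
            have := (hH.hub_conn_mark_iff hbot hh' (Or.inl rfl)).1 ih.2
            obtain ⟨e', he', hl''⟩ := this
            rw [hfr e' (mem_edgesAt_of_link_hub hh' hl'')] at he'
            exact Bool.noConfusion he'
          · exact hcM (G.self_mem_cluster ω c)
        · exact ⟨hzc, ih.2.trans (hstep y z hstep' ih.1 hzc)⟩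
    exact hbot.1 (hwalk b hconn).2
  rw [this, Finset.card_empty]
  exact Nat.zero_le _

end Main

end MultiGraph

end PercRepro
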